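import Mathlib
import Summits.NavierStokesRegularity.NavierStokesRegularity.Theorems.FilamentSkeletonRssMatchedKernelNormalBlockTools

/-!
# Matched-core normal block, SELF part: the normal block of the matched Biot–Savart gradient AT a point of the filament is a
# near-rotation (variable core `mc(u) ∈ [m₁, m₂]`)

μ-parametrised port of `SelectionBoxRJRung.self_normalBlock_symm_le` / `self_normalBlock_anti_ge` (`…RungNormalBlockSelf`, lane 19175-p1
g8, unit core) to the matched kernel of the A1G cone (kit §5(d)).  Let `X` be a `C²` unit-speed filament with curvature `‖X″‖ ≤ κ₀` and linear
growth, `mc : ℝ → ℝ` a continuous core profile with `m₁ ≤ mc u` (`m₁ > 0`), `F(y) = ∫ ((‖y − X u‖² + mc u)^{3/2})⁻¹ • X′u × (y − X u) du`,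
`y₀ = X c`, and the curve seen from `y₀` in two regions as in the unit-core file (`κ₀ S₁ ≤ 1/2`; distance `≥ D₁` and escape `c₁|u − c| − A₁`
beyond `S₁`).  For unit `h, l, m, n ⊥ X′ c`:

* `matched_self_normalBlock_symm_le` — `|⟪DF h, l⟫ + ⟪DF l, h⟫| ≤ 2 (192π κ₀/√m₁ + 8π(D₁ + A₁)/(c₁ D₁³))`;
* `matched_self_normalBlock_anti_ge` — if moreover `mc u ≤ m₂` for `|u − c| ≤ √m₂`:
  `σ (⟪DF n, m⟫ − ⟪DF m, n⟫) ≥ (4/3) σ²/m₂ − (416π κ₀/√m₁ + 20π(D₁ + A₁)/(c₁ D₁³))`, `σ = ⟪X′ c, n × m⟫` —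
  the solid-body rotation of the matched core (rate `≳ 1/m₂`), against curvature errors `O(κ₀/√m₁)` and the core-free far part.

Same architecture and SAME numerical constants as the unit-core proofs; only the Region-A majorant is rescaled to the core
(`(1 + s²)⁻¹ ↦ (m₁ + s²)⁻¹`, integral `π/√m₁`) and the rotation window is `|u − c| ≤ √m₂` (kernel `≥ (1/3) m₂^{-3/2}` there).
Lane ns-filament-19175-p1 g11; `--supports stmt-NavierStokesRegularity-27849` (determinant half of `stub_normalBlock`).  HONEST FRAMING: kernel
estimates about a HYPOTHETICAL filament skeleton on the NEGATIVE side of a MODEL route; nothing here bears on Navier–Stokes regularity or blow-up.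
-/

set_option linter.dupNamespace false

noncomputable section

namespace Summit.NavierStokesRegularity.NavierStokesRegularity.Theorems.MatchedKernel

open Set Function Filter MeasureTheory Real
open Literature.Analysis.FluidPDE
open Summit.NavierStokesRegularity.NavierStokesRegularity.Theorems.SelectionBoxRJRung
open scoped InnerProductSpace Topology

/-- **Symmetrised normal entries of the matched self-gradient are small.**  `X` `C²` with `‖X′‖ ≡ 1`, `‖X″‖ ≤ κ₀`, linear growth
`c₀|u| − C ≤ ‖X u‖`; core profile `mc` continuous with `m₁ ≤ mc` (`m₁ > 0`); seen from `y₀ = X c`: `κ₀ S₁ ≤ 1/2`, distance `≥ D₁` for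
`|u − c| ≥ S₁`, escape `c₁|u − c| − A₁ ≤ ‖X c − X u‖`.  Then for unit `h, l ⊥ X′ c`:
`|⟪DF(y₀) h, l⟫ + ⟪DF(y₀) l, h⟫| ≤ 2 (192π κ₀/√m₁ + 8π (D₁ + A₁)/(c₁ D₁³))`. [folklore] -/
theorem matched_self_normalBlock_symm_le {X : ℝ → EuclideanSpace ℝ (Fin 3)} {mc : ℝ → ℝ} {m₁ κ₀ c₀ C S₁ D₁ c₁ A₁ c : ℝ}
    (hm₁ : 0 < m₁) (hmm : ∀ u, m₁ ≤ mc u) (hmc : Continuous mc)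
    (hX : ContDiff ℝ 2 X) (hunit : ∀ u, ‖deriv X u‖ = 1) (hκ : ∀ u, ‖deriv (deriv X) u‖ ≤ κ₀)
    (hc₀ : 0 < c₀) (hgrow : ∀ u, c₀ * |u| - C ≤ ‖X u‖)
    (hS₁ : κ₀ * S₁ ≤ 1 / 2) (hc₁ : 0 < c₁) (hD₁ : 0 < D₁) (hA₁ : 0 ≤ A₁)
    (hfar : ∀ u, S₁ ≤ |u - c| → D₁ ≤ ‖X c - X u‖) (hesc : ∀ u, c₁ * |u - c| - A₁ ≤ ‖X c - X u‖)
    {h l : EuclideanSpace ℝ (Fin 3)} (hh : ‖h‖ = 1) (hl : ‖l‖ = 1)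
    (hht : ⟪h, deriv X c⟫_ℝ = 0) (hlt : ⟪l, deriv X c⟫_ℝ = 0) :
    |⟪fderiv ℝ (fun y : EuclideanSpace ℝ (Fin 3) => ∫ u : ℝ,
        ((‖y - X u‖ ^ 2 + mc u) ^ (3 / 2 : ℝ))⁻¹ • cross (deriv X u) (y - X u)) (X c) h, l⟫_ℝ +
      ⟪fderiv ℝ (fun y : EuclideanSpace ℝ (Fin 3) => ∫ u : ℝ,
        ((‖y - X u‖ ^ 2 + mc u) ^ (3 / 2 : ℝ))⁻¹ • cross (deriv X u) (y - X u)) (X c) l, h⟫_ℝ| ≤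
      2 * (192 * Real.pi * κ₀ / Real.sqrt m₁ + 8 * Real.pi * (D₁ + A₁) / (c₁ * D₁ ^ 3)) := by
  have hX1 : ContDiff ℝ 1 X := hX.of_le (by norm_num)
  have hdX : ∀ u, ‖deriv X u‖ ≤ 1 := fun u => (hunit u).le
  have hκ0 : 0 ≤ κ₀ := (norm_nonneg _).trans (hκ c)
  have hsq : 0 < Real.sqrt m₁ := Real.sqrt_pos.2 hm₁
  -- the derivative integrand in the direction `v`
  obtain ⟨I, hI⟩ : ∃ I : EuclideanSpace ℝ (Fin 3) → ℝ → EuclideanSpace ℝ (Fin 3), I = fun v u =>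
      (-3 * ⟪X c - X u, v⟫_ℝ * ((‖X c - X u‖ ^ 2 + mc u) ^ (5 / 2 : ℝ))⁻¹) • cross (deriv X u) (X c - X u)
        + ((‖X c - X u‖ ^ 2 + mc u) ^ (3 / 2 : ℝ))⁻¹ • cross (deriv X u) v := ⟨_, rfl⟩
  have hInt : ∀ v, Integrable (I v) := fun v => by
    have h0 := (matchedBiotSavart_directionalDeriv hm₁ hmm hmc hc₀ hX1 hdX hgrow (X c) v).1
    rw [hI]; exact h0
  have happ : ∀ v, fderiv ℝ (fun y : EuclideanSpace ℝ (Fin 3) => ∫ u : ℝ,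
      ((‖y - X u‖ ^ 2 + mc u) ^ (3 / 2 : ℝ))⁻¹ • cross (deriv X u) (y - X u)) (X c) v = ∫ u, I v u := fun v => by
    have h0 := matchedBiotSavart_fderiv_apply_eq hm₁ hmm hmc hc₀ hX1 hdX hgrow (X c) v
    rw [hI]; exact h0
  rw [real_inner_comm l, real_inner_comm h, happ h, happ l, ← integral_inner (hInt h) l, ← integral_inner (hInt l) h,
    ← integral_add ((hInt h).const_inner l) ((hInt l).const_inner h)]
  -- the two-region majorant
  obtain ⟨k, hk⟩ : ∃ k : ℝ, k = c₁ / (D₁ + A₁) := ⟨_, rfl⟩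
  have hkpos : 0 < k := by rw [hk]; exact div_pos hc₁ (by linarith)
  have hks : ∀ s : ℝ, c₁ * s / (D₁ + A₁) = k * s := fun s => by rw [hk]; ring
  obtain ⟨hGint, hGval⟩ := coreRegion_majorant_integral hm₁ c (384 * κ₀) (16 / D₁ ^ 3) hkpos
  have hpt : ∀ u, ‖⟪l, I h u⟫_ℝ + ⟪h, I l u⟫_ℝ‖ ≤
      384 * κ₀ * (m₁ + (u - c) ^ 2)⁻¹ + 16 / D₁ ^ 3 * (1 + (k * (u - c)) ^ 2)⁻¹ := by
    intro u
    rw [Real.norm_eq_abs]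
    have hzle : ‖X c - X u‖ ≤ |u - c| := chord_le hX hunit c u
    refine coreRegion_dominate (S₁ := S₁) hm₁ (by positivity) (by positivity) (fun hs => ?_) (fun hs => ?_)
    · -- region A: `|u − c| ≤ S₁`
      have hsk : κ₀ * |u - c| ≤ 1 / 2 := (mul_le_mul_of_nonneg_left hs hκ0).trans hS₁
      have hzge : |u - c| / 2 ≤ ‖X c - X u‖ := chord_ge_half hX hunit hκ hsk
      have hzh := inner_chord_normal_le hX hκ hh.le hht u
      have hzl := inner_chord_normal_le hX hκ hl.le hlt u
      have h0 := (cross_pairing_identities (deriv X u) h l).1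
      have hid : ⟪l, I h u⟫_ℝ + ⟪h, I l u⟫_ℝ =
          (-3 * ⟪X c - X u, h⟫_ℝ * ((‖X c - X u‖ ^ 2 + mc u) ^ (5 / 2 : ℝ))⁻¹) *
              ⟪cross (deriv X u) (X c - X u), l⟫_ℝ +
            (-3 * ⟪X c - X u, l⟫_ℝ * ((‖X c - X u‖ ^ 2 + mc u) ^ (5 / 2 : ℝ))⁻¹) *
              ⟪cross (deriv X u) (X c - X u), h⟫_ℝ := by
        rw [hI]; dsimp only
        rw [inner_add_right, inner_add_right, real_inner_smul_right, real_inner_smul_right, real_inner_smul_right,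
          real_inner_smul_right, real_inner_comm (cross (deriv X u) (X c - X u)) l,
          real_inner_comm (cross (deriv X u) (X c - X u)) h, real_inner_comm (cross (deriv X u) h) l,
          real_inner_comm (cross (deriv X u) l) h]
        linear_combination ((‖X c - X u‖ ^ 2 + mc u) ^ (3 / 2 : ℝ))⁻¹ * h0
      rw [hid]
      calc _ ≤ |(-3 * ⟪X c - X u, h⟫_ℝ * ((‖X c - X u‖ ^ 2 + mc u) ^ (5 / 2 : ℝ))⁻¹) *
                ⟪cross (deriv X u) (X c - X u), l⟫_ℝ| +
              |(-3 * ⟪X c - X u, l⟫_ℝ * ((‖X c - X u‖ ^ 2 + mc u) ^ (5 / 2 : ℝ))⁻¹) *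
                ⟪cross (deriv X u) (X c - X u), h⟫_ℝ| := abs_add_le _ _
        _ ≤ 192 * κ₀ * (m₁ + (u - c) ^ 2)⁻¹ + 192 * κ₀ * (m₁ + (u - c) ^ 2)⁻¹ :=
            add_le_add (gradIntegrand_curv_le_core hm₁ (hmm u) (hdX u) hl.le hκ0 hzh hzle hzge)
              (gradIntegrand_curv_le_core hm₁ (hmm u) (hdX u) hh.le hκ0 hzl hzle hzge)
        _ = 384 * κ₀ * (m₁ + (u - c) ^ 2)⁻¹ := by ring
    · -- region B: `S₁ ≤ |u − c|`
      have hq0 : 0 ≤ mc u := hm₁.le.trans (hmm u)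
      obtain ⟨-, hIh, -⟩ := gradIntegrand_far_le_core hq0 (v := h) (s := u - c) (hdX u) hc₁ hD₁ hA₁ (hfar u hs) (hesc u)
      obtain ⟨-, hIl, -⟩ := gradIntegrand_far_le_core hq0 (v := l) (s := u - c) (hdX u) hc₁ hD₁ hA₁ (hfar u hs) (hesc u)
      rw [hh, hks] at hIh
      rw [hl, hks] at hIl
      have hIh' : ‖I h u‖ ≤ 8 * 1 / D₁ ^ 3 * (1 + (k * (u - c)) ^ 2)⁻¹ := by rw [hI]; exact hIh
      have hIl' : ‖I l u‖ ≤ 8 * 1 / D₁ ^ 3 * (1 + (k * (u - c)) ^ 2)⁻¹ := by rw [hI]; exact hIl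
      calc |⟪l, I h u⟫_ℝ + ⟪h, I l u⟫_ℝ| ≤ |⟪l, I h u⟫_ℝ| + |⟪h, I l u⟫_ℝ| := abs_add_le _ _
        _ ≤ ‖l‖ * ‖I h u‖ + ‖h‖ * ‖I l u‖ := add_le_add (abs_real_inner_le_norm _ _) (abs_real_inner_le_norm _ _)
        _ ≤ 1 * (8 * 1 / D₁ ^ 3 * (1 + (k * (u - c)) ^ 2)⁻¹) + 1 * (8 * 1 / D₁ ^ 3 * (1 + (k * (u - c)) ^ 2)⁻¹) :=
            add_le_add (mul_le_mul hl.le hIh' (norm_nonneg _) zero_le_one)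
              (mul_le_mul hh.le hIl' (norm_nonneg _) zero_le_one)
        _ = 16 / D₁ ^ 3 * (1 + (k * (u - c)) ^ 2)⁻¹ := by ring
  have hfin : 384 * κ₀ * (Real.pi / Real.sqrt m₁) + 16 / D₁ ^ 3 * (Real.pi / k) =
      2 * (192 * Real.pi * κ₀ / Real.sqrt m₁ + 8 * Real.pi * (D₁ + A₁) / (c₁ * D₁ ^ 3)) := by
    rw [hk]; field_simp; ring
  calc |∫ u, (⟪l, I h u⟫_ℝ + ⟪h, I l u⟫_ℝ)| = ‖∫ u, (⟪l, I h u⟫_ℝ + ⟪h, I l u⟫_ℝ)‖ := (Real.norm_eq_abs _).symm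
    _ ≤ ∫ u, (384 * κ₀ * (m₁ + (u - c) ^ 2)⁻¹ + 16 / D₁ ^ 3 * (1 + (k * (u - c)) ^ 2)⁻¹) :=
        norm_integral_le_of_norm_le hGint (Eventually.of_forall hpt)
    _ = _ := hGval
    _ = _ := hfin

/-- **The antisymmetric normal entry of the matched self-gradient is a definite rotation.**  Under the hypotheses of
`matched_self_normalBlock_symm_le` and the UPPER core bound `mc u ≤ m₂` on the rotation window `|u − c| ≤ √m₂` (`m₂ > 0`), for unit
`m, n ⊥ X′ c` and `σ = ⟪X′ c, n × m⟫`: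
`(4/3) σ²/m₂ − (416π κ₀/√m₁ + 20π (D₁ + A₁)/(c₁ D₁³)) ≤ σ (⟪DF(y₀) n, m⟫ − ⟪DF(y₀) m, n⟫)`. [folklore] -/
theorem matched_self_normalBlock_anti_ge {X : ℝ → EuclideanSpace ℝ (Fin 3)} {mc : ℝ → ℝ} {m₁ m₂ κ₀ c₀ C S₁ D₁ c₁ A₁ c : ℝ}
    (hm₁ : 0 < m₁) (hmm : ∀ u, m₁ ≤ mc u) (hmc : Continuous mc)
    (hm₂ : 0 < m₂) (hmm₂ : ∀ u, |u - c| ≤ Real.sqrt m₂ → mc u ≤ m₂)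
    (hX : ContDiff ℝ 2 X) (hunit : ∀ u, ‖deriv X u‖ = 1) (hκ : ∀ u, ‖deriv (deriv X) u‖ ≤ κ₀)
    (hc₀ : 0 < c₀) (hgrow : ∀ u, c₀ * |u| - C ≤ ‖X u‖)
    (hS₁ : κ₀ * S₁ ≤ 1 / 2) (hc₁ : 0 < c₁) (hD₁ : 0 < D₁) (hA₁ : 0 ≤ A₁)
    (hfar : ∀ u, S₁ ≤ |u - c| → D₁ ≤ ‖X c - X u‖) (hesc : ∀ u, c₁ * |u - c| - A₁ ≤ ‖X c - X u‖)
    {m n : EuclideanSpace ℝ (Fin 3)} (hm : ‖m‖ = 1) (hn : ‖n‖ = 1)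
    (hmt : ⟪m, deriv X c⟫_ℝ = 0) (hnt : ⟪n, deriv X c⟫_ℝ = 0) :
    4 / 3 * ⟪deriv X c, cross n m⟫_ℝ ^ 2 / m₂ - (416 * Real.pi * κ₀ / Real.sqrt m₁ + 20 * Real.pi * (D₁ + A₁) / (c₁ * D₁ ^ 3)) ≤
      ⟪deriv X c, cross n m⟫_ℝ *
        (⟪fderiv ℝ (fun y : EuclideanSpace ℝ (Fin 3) => ∫ u : ℝ,
            ((‖y - X u‖ ^ 2 + mc u) ^ (3 / 2 : ℝ))⁻¹ • cross (deriv X u) (y - X u)) (X c) n, m⟫_ℝ -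
          ⟪fderiv ℝ (fun y : EuclideanSpace ℝ (Fin 3) => ∫ u : ℝ,
            ((‖y - X u‖ ^ 2 + mc u) ^ (3 / 2 : ℝ))⁻¹ • cross (deriv X u) (y - X u)) (X c) m, n⟫_ℝ) := by
  have hX1 : ContDiff ℝ 1 X := hX.of_le (by norm_num)
  have hdX : ∀ u, ‖deriv X u‖ ≤ 1 := fun u => (hunit u).le
  have hκ0 : 0 ≤ κ₀ := (norm_nonneg _).trans (hκ c)
  have hsq1 : 0 < Real.sqrt m₁ := Real.sqrt_pos.2 hm₁
  have hsq2 : 0 < Real.sqrt m₂ := Real.sqrt_pos.2 hm₂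
  -- the derivative integrand in the direction `v`
  obtain ⟨I, hI⟩ : ∃ I : EuclideanSpace ℝ (Fin 3) → ℝ → EuclideanSpace ℝ (Fin 3), I = fun v u =>
      (-3 * ⟪X c - X u, v⟫_ℝ * ((‖X c - X u‖ ^ 2 + mc u) ^ (5 / 2 : ℝ))⁻¹) • cross (deriv X u) (X c - X u)
        + ((‖X c - X u‖ ^ 2 + mc u) ^ (3 / 2 : ℝ))⁻¹ • cross (deriv X u) v := ⟨_, rfl⟩
  have hInt : ∀ v, Integrable (I v) := fun v => by
    have h0 := (matchedBiotSavart_directionalDeriv hm₁ hmm hmc hc₀ hX1 hdX hgrow (X c) v).1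
    rw [hI]; exact h0
  have happ : ∀ v, fderiv ℝ (fun y : EuclideanSpace ℝ (Fin 3) => ∫ u : ℝ,
      ((‖y - X u‖ ^ 2 + mc u) ^ (3 / 2 : ℝ))⁻¹ • cross (deriv X u) (y - X u)) (X c) v = ∫ u, I v u := fun v => by
    have h0 := matchedBiotSavart_fderiv_apply_eq hm₁ hmm hmc hc₀ hX1 hdX hgrow (X c) v
    rw [hI]; exact h0
  rw [real_inner_comm m, real_inner_comm n, happ n, happ m, ← integral_inner (hInt n) m, ← integral_inner (hInt m) n,
    ← integral_sub ((hInt n).const_inner m) ((hInt m).const_inner n), ← integral_const_mul]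
  -- abbreviations
  obtain ⟨σ, hσ⟩ : ∃ σ : ℝ, σ = ⟪deriv X c, cross n m⟫_ℝ := ⟨_, rfl⟩
  have hx1 : ‖cross n m‖ ≤ 1 := norm_cross_le_one hn.le hm.le
  have hσ1 : |σ| ≤ 1 := by
    rw [hσ]
    calc |⟪deriv X c, cross n m⟫_ℝ| ≤ ‖deriv X c‖ * ‖cross n m‖ := abs_real_inner_le_norm _ _
      _ ≤ 1 * 1 := mul_le_mul (hdX c) hx1 (norm_nonneg _) zero_le_one
      _ = 1 := one_mul _
  have hσ2 : σ ^ 2 ≤ 1 := by rw [← sq_abs]; nlinarith [abs_nonneg σ]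
  rw [← hσ]
  obtain ⟨k, hk⟩ : ∃ k : ℝ, k = c₁ / (D₁ + A₁) := ⟨_, rfl⟩
  have hkpos : 0 < k := by rw [hk]; exact div_pos hc₁ (by linarith)
  have hks : ∀ s : ℝ, c₁ * s / (D₁ + A₁) = k * s := fun s => by rw [hk]; ring
  -- the kernel `K₃` along the chord: continuity, integrability, lower bound of its integral
  obtain ⟨K, hK⟩ : ∃ K : ℝ → ℝ, K = fun u => ((‖X c - X u‖ ^ 2 + mc u) ^ (3 / 2 : ℝ))⁻¹ := ⟨_, rfl⟩
  have hXc : Continuous X := hX.continuous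
  have hKcont : Continuous K := by rw [hK]; exact continuous_kernel hm₁ hmm hmc hXc (X c) _
  have hKnn : ∀ u, 0 ≤ K u := fun u => by rw [hK]; exact (kernel_le_core hm₁ (hmm u) _ _ (by norm_num)).2
  have hKle : ∀ u, K u ≤ (m₁ ^ (3 / 2 : ℝ))⁻¹ := fun u => by rw [hK]; exact (kernel_le_core hm₁ (hmm u) _ _ (by norm_num)).1
  have hM0 : 0 ≤ (m₁ ^ (3 / 2 : ℝ))⁻¹ := inv_nonneg.2 (Real.rpow_nonneg hm₁.le _)
  have hKfar : ∀ u, S₁ ≤ |u - c| → K u ≤ 2 / D₁ ^ 3 * (1 + (k * (u - c)) ^ 2)⁻¹ := fun u hs => by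
    obtain ⟨-, -, h3⟩ := gradIntegrand_far_le_core (hm₁.le.trans (hmm u)) (v := m) (s := u - c) (hdX u) hc₁ hD₁ hA₁
      (hfar u hs) (hesc u)
    rw [hks] at h3; rw [hK]; exact h3
  have hBint : Integrable (fun u : ℝ => 2 / D₁ ^ 3 * (1 + (k * (u - c)) ^ 2)⁻¹) := by
    have h := (twoRegion_majorant_integral c 0 (2 / D₁ ^ 3) hkpos).1
    simpa using h
  have hIccInt : IntegrableOn (fun _ : ℝ => (m₁ ^ (3 / 2 : ℝ))⁻¹) (Icc (c - S₁) (c + S₁)) := continuousOn_const.integrableOn_Icc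
  have hKint : Integrable K := by
    refine Integrable.mono' ((hIccInt.integrable_indicator measurableSet_Icc).add hBint) hKcont.aestronglyMeasurable
      (Eventually.of_forall fun u => ?_)
    rw [Real.norm_of_nonneg (hKnn u)]
    rcases le_total |u - c| S₁ with hs | hs
    · have hmem : u ∈ Icc (c - S₁) (c + S₁) := by
        rw [abs_le] at hs; exact ⟨by linarith [hs.1], by linarith [hs.2]⟩
      have : (Icc (c - S₁) (c + S₁)).indicator (fun _ : ℝ => (m₁ ^ (3 / 2 : ℝ))⁻¹) u = (m₁ ^ (3 / 2 : ℝ))⁻¹ := by simp [hmem]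
      rw [Pi.add_apply, this]
      have : 0 ≤ 2 / D₁ ^ 3 * (1 + (k * (u - c)) ^ 2)⁻¹ := by positivity
      linarith [hKle u]
    · have h0 : 0 ≤ (Icc (c - S₁) (c + S₁)).indicator (fun _ : ℝ => (m₁ ^ (3 / 2 : ℝ))⁻¹) u :=
        Set.indicator_nonneg (fun _ _ => hM0) u
      rw [Pi.add_apply]
      linarith [hKfar u hs]
  -- the rotation window `|u − c| ≤ √m₂`: there `K ≥ (1/3) m₂^{-3/2}`, so `∫ K ≥ (2/3)/m₂`
  have hKlow : 2 / 3 * m₂⁻¹ ≤ ∫ u, K u := by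
    have h1 : ∫ u in Icc (c - Real.sqrt m₂) (c + Real.sqrt m₂), (1 / 3 * (m₂ ^ (3 / 2 : ℝ))⁻¹ : ℝ) ≤
        ∫ u in Icc (c - Real.sqrt m₂) (c + Real.sqrt m₂), K u := by
      refine setIntegral_mono_on continuousOn_const.integrableOn_Icc hKint.integrableOn measurableSet_Icc fun u hu => ?_
      have hs : |u - c| ≤ Real.sqrt m₂ := abs_le.2 ⟨by linarith [hu.1], by linarith [hu.2]⟩
      have hr : ‖X c - X u‖ ^ 2 ≤ m₂ := by
        have h0 : ‖X c - X u‖ ≤ Real.sqrt m₂ := (chord_le hX hunit c u).trans hs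
        have h2 := pow_le_pow_left₀ (norm_nonneg _) h0 2
        rwa [Real.sq_sqrt hm₂.le] at h2
      rw [hK]
      exact kernel3_ge_core hm₂ (hm₁.trans_le (hmm u)) (hmm₂ u hs) hr
    have h2 : ∫ u in Icc (c - Real.sqrt m₂) (c + Real.sqrt m₂), K u ≤ ∫ u, K u :=
      setIntegral_le_integral hKint (Eventually.of_forall hKnn)
    have h0 : ∫ _ in Icc (c - Real.sqrt m₂) (c + Real.sqrt m₂), (1 / 3 * (m₂ ^ (3 / 2 : ℝ))⁻¹ : ℝ) = 2 / 3 * m₂⁻¹ := by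
      rw [setIntegral_const, Real.volume_real_Icc_of_le (by linarith), smul_eq_mul]
      have h32 : m₂ ^ (3 / 2 : ℝ) = m₂ * Real.sqrt m₂ := by
        rw [show (3 / 2 : ℝ) = 1 + 1 / 2 by norm_num, Real.rpow_add hm₂, Real.rpow_one, Real.sqrt_eq_rpow]
      rw [h32]
      field_simp
      ring
    linarith
  -- the two-region majorant of everything but the rotation
  obtain ⟨hGint, hGval⟩ := coreRegion_majorant_integral hm₁ c (416 * κ₀) (20 / D₁ ^ 3) hkpos
  have hpt : ∀ u, 2 * σ ^ 2 * K u - (416 * κ₀ * (m₁ + (u - c) ^ 2)⁻¹ + 20 / D₁ ^ 3 * (1 + (k * (u - c)) ^ 2)⁻¹) ≤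
      σ * (⟪m, I n u⟫_ℝ - ⟪n, I m u⟫_ℝ) := by
    intro u
    have hzle : ‖X c - X u‖ ≤ |u - c| := chord_le hX hunit c u
    have hq : 2 * σ ^ 2 * K u - σ * (⟪m, I n u⟫_ℝ - ⟪n, I m u⟫_ℝ) ≤
        416 * κ₀ * (m₁ + (u - c) ^ 2)⁻¹ + 20 / D₁ ^ 3 * (1 + (k * (u - c)) ^ 2)⁻¹ := by
      refine coreRegion_dominate (S₁ := S₁) hm₁ (by positivity) (by positivity) (fun hs => ?_) (fun hs => ?_)
      · -- region A
        have hsk : κ₀ * |u - c| ≤ 1 / 2 := (mul_le_mul_of_nonneg_left hs hκ0).trans hS₁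
        have hzge : |u - c| / 2 ≤ ‖X c - X u‖ := chord_ge_half hX hunit hκ hsk
        have hzn := inner_chord_normal_le hX hκ hn.le hnt u
        have hzm := inner_chord_normal_le hX hκ hm.le hmt u
        have hTt : ‖deriv X u - deriv X c‖ ≤ κ₀ * |u - c| := tangent_sub_le hX hκ c u
        have h2 := (cross_pairing_identities (deriv X u) n m).2
        have h3 : ⟪deriv X u, cross n m⟫_ℝ = σ + ⟪deriv X u - deriv X c, cross n m⟫_ℝ := by
          rw [inner_sub_left, hσ]; ring
        have hid : σ * (⟪m, I n u⟫_ℝ - ⟪n, I m u⟫_ℝ) = 2 * σ ^ 2 * K u +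
            σ * ((-3 * ⟪X c - X u, n⟫_ℝ * ((‖X c - X u‖ ^ 2 + mc u) ^ (5 / 2 : ℝ))⁻¹) *
                  ⟪cross (deriv X u) (X c - X u), m⟫_ℝ -
                (-3 * ⟪X c - X u, m⟫_ℝ * ((‖X c - X u‖ ^ 2 + mc u) ^ (5 / 2 : ℝ))⁻¹) *
                  ⟪cross (deriv X u) (X c - X u), n⟫_ℝ) +
            2 * K u * σ * ⟪deriv X u - deriv X c, cross n m⟫_ℝ := by
          rw [hI, hK]; dsimp only
          rw [inner_add_right, inner_add_right, real_inner_smul_right, real_inner_smul_right,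
            real_inner_smul_right, real_inner_smul_right, real_inner_comm (cross (deriv X u) (X c - X u)) m,
            real_inner_comm (cross (deriv X u) (X c - X u)) n, real_inner_comm (cross (deriv X u) n) m,
            real_inner_comm (cross (deriv X u) m) n]
          linear_combination (σ * ((‖X c - X u‖ ^ 2 + mc u) ^ (3 / 2 : ℝ))⁻¹) * h2 +
            (2 * σ * ((‖X c - X u‖ ^ 2 + mc u) ^ (3 / 2 : ℝ))⁻¹) * h3
        have hA1 := gradIntegrand_curv_le_core hm₁ (hmm u) (hdX u) hm.le hκ0 hzn hzle hzge
        have hA2 := gradIntegrand_curv_le_core hm₁ (hmm u) (hdX u) hn.le hκ0 hzm hzle hzge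
        have hB := gradIntegrand_turn_le_core hm₁ (hmm u) (x := cross n m) hTt hx1 hσ1 hκ0 hzge
        have hB' : |2 * K u * σ * ⟪deriv X u - deriv X c, cross n m⟫_ℝ| ≤ 32 * κ₀ * (m₁ + (u - c) ^ 2)⁻¹ := by
          simp only [hK]; exact hB
        rw [hid]
        have e1 := neg_abs_le (σ * ((-3 * ⟪X c - X u, n⟫_ℝ * ((‖X c - X u‖ ^ 2 + mc u) ^ (5 / 2 : ℝ))⁻¹) *
                  ⟪cross (deriv X u) (X c - X u), m⟫_ℝ -
                (-3 * ⟪X c - X u, m⟫_ℝ * ((‖X c - X u‖ ^ 2 + mc u) ^ (5 / 2 : ℝ))⁻¹) *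
                  ⟪cross (deriv X u) (X c - X u), n⟫_ℝ))
        have e2 := neg_abs_le (2 * K u * σ * ⟪deriv X u - deriv X c, cross n m⟫_ℝ)
        have e3 : |σ * ((-3 * ⟪X c - X u, n⟫_ℝ * ((‖X c - X u‖ ^ 2 + mc u) ^ (5 / 2 : ℝ))⁻¹) *
                  ⟪cross (deriv X u) (X c - X u), m⟫_ℝ -
                (-3 * ⟪X c - X u, m⟫_ℝ * ((‖X c - X u‖ ^ 2 + mc u) ^ (5 / 2 : ℝ))⁻¹) *
                  ⟪cross (deriv X u) (X c - X u), n⟫_ℝ)| ≤ 384 * κ₀ * (m₁ + (u - c) ^ 2)⁻¹ := by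
          rw [abs_mul]
          have h4 := abs_sub _ _ |>.trans (add_le_add hA1 hA2)
          calc _ ≤ 1 * (192 * κ₀ * (m₁ + (u - c) ^ 2)⁻¹ + 192 * κ₀ * (m₁ + (u - c) ^ 2)⁻¹) :=
                mul_le_mul hσ1 h4 (abs_nonneg _) zero_le_one
            _ = _ := by ring
        linarith
      · -- region B
        have hq0 : 0 ≤ mc u := hm₁.le.trans (hmm u)
        obtain ⟨-, hIn, hK3⟩ := gradIntegrand_far_le_core hq0 (v := n) (s := u - c) (hdX u) hc₁ hD₁ hA₁ (hfar u hs) (hesc u)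
        obtain ⟨-, hIm, -⟩ := gradIntegrand_far_le_core hq0 (v := m) (s := u - c) (hdX u) hc₁ hD₁ hA₁ (hfar u hs) (hesc u)
        rw [hn, hks] at hIn
        rw [hm, hks] at hIm
        rw [hks] at hK3
        have hIn' : ‖I n u‖ ≤ 8 * 1 / D₁ ^ 3 * (1 + (k * (u - c)) ^ 2)⁻¹ := by rw [hI]; exact hIn
        have hIm' : ‖I m u‖ ≤ 8 * 1 / D₁ ^ 3 * (1 + (k * (u - c)) ^ 2)⁻¹ := by rw [hI]; exact hIm
        have hK3' : K u ≤ 2 / D₁ ^ 3 * (1 + (k * (u - c)) ^ 2)⁻¹ := by rw [hK]; exact hK3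
        have hΦ : |⟪m, I n u⟫_ℝ - ⟪n, I m u⟫_ℝ| ≤ 16 / D₁ ^ 3 * (1 + (k * (u - c)) ^ 2)⁻¹ := by
          calc |⟪m, I n u⟫_ℝ - ⟪n, I m u⟫_ℝ| ≤ |⟪m, I n u⟫_ℝ| + |⟪n, I m u⟫_ℝ| := abs_sub _ _
            _ ≤ ‖m‖ * ‖I n u‖ + ‖n‖ * ‖I m u‖ :=
                add_le_add (abs_real_inner_le_norm _ _) (abs_real_inner_le_norm _ _)
            _ ≤ 1 * (8 * 1 / D₁ ^ 3 * (1 + (k * (u - c)) ^ 2)⁻¹) +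
                  1 * (8 * 1 / D₁ ^ 3 * (1 + (k * (u - c)) ^ 2)⁻¹) :=
                add_le_add (mul_le_mul hm.le hIn' (norm_nonneg _) zero_le_one)
                  (mul_le_mul hn.le hIm' (norm_nonneg _) zero_le_one)
            _ = 16 / D₁ ^ 3 * (1 + (k * (u - c)) ^ 2)⁻¹ := by ring
        have e1 : |σ * (⟪m, I n u⟫_ℝ - ⟪n, I m u⟫_ℝ)| ≤ 16 / D₁ ^ 3 * (1 + (k * (u - c)) ^ 2)⁻¹ := by
          rw [abs_mul]
          calc |σ| * |⟪m, I n u⟫_ℝ - ⟪n, I m u⟫_ℝ| ≤ 1 * (16 / D₁ ^ 3 * (1 + (k * (u - c)) ^ 2)⁻¹) :=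
                mul_le_mul hσ1 hΦ (abs_nonneg _) zero_le_one
            _ = _ := one_mul _
        have e2 := neg_abs_le (σ * (⟪m, I n u⟫_ℝ - ⟪n, I m u⟫_ℝ))
        have hQ0 : 0 ≤ 2 / D₁ ^ 3 * (1 + (k * (u - c)) ^ 2)⁻¹ := by positivity
        have e3 : 2 * σ ^ 2 * K u ≤ 2 * 1 * (2 / D₁ ^ 3 * (1 + (k * (u - c)) ^ 2)⁻¹) :=
          mul_le_mul (by linarith) hK3' (hKnn u) (by norm_num)
        have e4 : 2 * σ ^ 2 * K u - σ * (⟪m, I n u⟫_ℝ - ⟪n, I m u⟫_ℝ) ≤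
            2 * 1 * (2 / D₁ ^ 3 * (1 + (k * (u - c)) ^ 2)⁻¹) + 16 / D₁ ^ 3 * (1 + (k * (u - c)) ^ 2)⁻¹ := by
          linarith
        calc _ ≤ _ := e4
          _ = 20 / D₁ ^ 3 * (1 + (k * (u - c)) ^ 2)⁻¹ := by ring
    linarith
  -- integrate
  have hE : 416 * κ₀ * (Real.pi / Real.sqrt m₁) + 20 / D₁ ^ 3 * (Real.pi / k) =
      416 * Real.pi * κ₀ / Real.sqrt m₁ + 20 * Real.pi * (D₁ + A₁) / (c₁ * D₁ ^ 3) := by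
    rw [hk, div_div_eq_mul_div]; field_simp
  have hlhs_int : Integrable (fun u => 2 * σ ^ 2 * K u -
      (416 * κ₀ * (m₁ + (u - c) ^ 2)⁻¹ + 20 / D₁ ^ 3 * (1 + (k * (u - c)) ^ 2)⁻¹)) := (hKint.const_mul _).sub hGint
  have hrhs_int : Integrable (fun u => σ * (⟪m, I n u⟫_ℝ - ⟪n, I m u⟫_ℝ)) :=
    (((hInt n).const_inner m).sub ((hInt m).const_inner n)).const_mul σ
  have hm2i : 0 ≤ m₂⁻¹ := inv_nonneg.2 hm₂.le
  calc 4 / 3 * σ ^ 2 / m₂ - (416 * Real.pi * κ₀ / Real.sqrt m₁ + 20 * Real.pi * (D₁ + A₁) / (c₁ * D₁ ^ 3))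
      ≤ 2 * σ ^ 2 * (∫ u, K u) - (416 * κ₀ * (Real.pi / Real.sqrt m₁) + 20 / D₁ ^ 3 * (Real.pi / k)) := by
        rw [hE]
        have h1 : 4 / 3 * σ ^ 2 / m₂ = σ ^ 2 * (2 * (2 / 3 * m₂⁻¹)) := by rw [div_eq_mul_inv]; ring
        rw [h1]
        nlinarith [mul_le_mul_of_nonneg_left hKlow (sq_nonneg σ)]
    _ = ∫ u, (2 * σ ^ 2 * K u -
          (416 * κ₀ * (m₁ + (u - c) ^ 2)⁻¹ + 20 / D₁ ^ 3 * (1 + (k * (u - c)) ^ 2)⁻¹)) := by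
        rw [integral_sub (hKint.const_mul _) hGint, integral_const_mul, hGval]
    _ ≤ ∫ u, σ * (⟪m, I n u⟫_ℝ - ⟪n, I m u⟫_ℝ) := integral_mono hlhs_int hrhs_int fun u => hpt u

end Summit.NavierStokesRegularity.NavierStokesRegularity.Theorems.MatchedKernel
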